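import Literature.NumberTheory.EllipticCurves.LangTorsor
import Literature.NumberTheory.EllipticCurves.FrobeniusManinProofs
import Literature.NumberTheory.DiophantineGeometry.FunctionFieldGenusWeierstrassProofs
import Literature.NumberTheory.DiophantineGeometry.FunctionFieldGenusRiemannTheoremProofs
import Literature.NumberTheory.DiophantineGeometry.FunctionFieldDivisorsNegativeDegreeProofs
import Literature.NumberTheory.DiophantineGeometry.FunctionFieldAdelesProofs
import Mathlib.FieldTheory.Relrank
import Mathlib.FieldTheory.Galois.Basic
import Mathlib.Algebra.CharP.Algebra
import HarnessLib

/-!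
# The Lang torsor of an elliptic curve over a finite field, II: `λ = (φ - 1)^*`, its degree, and
the Galois property

Continuation of `LangTorsor` (evaluation at points, translations `τ_T`). For an elliptic curve `W`
over a finite field `k = 𝔽_q` with function field `K = k(W)`:

* `lam W : K →ₐ[k] K` — **the pull-back along `φ - 1`** (evaluation at Manin's point
  `P₋₁ = (t^q, s^q) - (t, s)`, `HasseManin.maninPt W (-1)`, which is not constant by Manin's degree
  computation `HasseManin.st_all`); `map_lam_genPt`, `lam_injective`;
* `map_transl_frobPt` (`τ_T(P₀) = P₀ + T`: translations commute with the Frobenius, which fixes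
  `W(k)`) and **`transl_comp_lam : τ_T ∘ λ = λ`** — the translations fix `λ(K)`;
* orders of polynomials in `t` (`ord_infPlace_algebraMap : ord_∞ p(t) = -2 deg p`,
  `ord_ofPrime_algebraMap_nonneg`), the pole divisor `(p(t))_∞ = 2 deg p · ∞`
  (`negPart_principalDivisor_algebraMap`) and **`finrank_adjoin_div_le`**:
  `[K : k(a(t)/b(t))] ≤ 2 deg a` for `deg b ≤ deg a` (Stichtenoth Thm. 1.4.11: the degree is the
  degree of the pole divisor, tree theorem `degree_negPart_principalDivisor_eq`);
* `gS_not_mem_adjoin_gT` (`s ∉ k(t)`), `finrank_adjoin_lam_gT_le` (`[K : k(λ t)] ≤ 2 #W(k)`),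
  `finrank_fieldRange_lam_le` (`[K : λ K] ≤ #W(k)`, as `λ s ∉ k(λ t)`);
* **`fieldRange_lam_eq_fixedField`**: `λ(K) = K^{τ(W(k))}` (Artin: the fixed field has codegree
  `#W(k)`), hence **`finrank_fieldRange_lam : [K : λ K] = #W(k)`** (`deg (φ - 1) = #E(k)`,
  Silverman *AEC* V.§1) and **`isGalois_fieldRange_lam`**: `K / λ(K)` is Galois, with group the
  (faithfully acting) translations — the function-field form of Lang's theorem that `1 - φ : E → E`
  is a Galois étale covering with group `E(k)`.

* `PlaceOver.pow_sub_self_ne_of_ord` (general: `a` with a pole of order prime to `p` is not of the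
  form `s^p - s`), `ord_infPlace_lam_gT = -2`, `ord_infPlace_lam_gS = -3` and the Artin–Schreier
  irreducibility hypotheses **`pow_sub_self_ne_smul_lam_gT`** (`p ≠ 2`) and
  **`pow_sub_self_ne_smul_lam_gS`** (`p ≠ 3`): `α λ(f) ∉ ℘(k(W))` for `f = x, y` — exactly the
  characteristic guards of `KohelShparlinski.CoordinateCharSumBound`.

Everything is proved; no named facts.

## References

* S. Lang, *Algebraic groups over finite fields*, Amer. J. Math. 78 (1956), 555–563.
* J. H. Silverman, *The Arithmetic of Elliptic Curves*, 2nd ed., GTM 106, III.4.8–4.10, V.§1.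
  [SilvermanAEC2009]
* J. S. Chahal, A. Soomro, J. Top, *A supplement to Manin's proof of the Hasse inequality*,
  Rocky Mountain J. Math. 44 (2014), Lemma 1.1. [ChahalSoomroTop2014]
* H. Stichtenoth, *Algebraic Function Fields and Codes*, 2nd ed., GTM 254, Thm. 1.4.11. [Stichtenoth2009]
-/

noncomputable section

open Polynomial WeierstrassCurve WeierstrassCurve.Affine
open scoped Polynomial.Bivariate

namespace Literature.NumberTheory.EllipticCurves.LangTorsor

open HasseManin

universe u v w

variable {F : Type u} [Field F] (W : WeierstrassCurve F)

/-! ### The pull-back `λ = (1 - φ)^*` along the Lang isogeny and its invariance under translations -/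

section Lang

variable {W} [W.IsElliptic] [DecidableEq F] [Fintype F]

omit [DecidableEq F] in
/-- **`x(P₋₁)` is not constant**: by Manin's degree computation (`HasseManin.st_all`), `x(P₀ - Q)`
is `a/b` in lowest terms with `deg b < deg a` (`= #W(k)`). [cite: ChahalSoomroTop2014, Lemma 1.1] -/
theorem xc_maninPt_neg_one_not_mem :
    xc W (maninPt W (-1)) ∉ Set.range (algebraMap F W.toAffine.FunctionField) := by
  rcases st_all W (-1) with ⟨h0, -⟩ | ⟨-, a, b, hrep, hlt, -⟩
  · exact absurd h0 (maninPt_neg_one_ne_zero W)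
  rintro ⟨c, hc⟩
  have hab : algebraMap F[X] W.toAffine.FunctionField (C c * b) =
      algebraMap F[X] W.toAffine.FunctionField a := by
    rw [map_mul, algebraMap_C, hc, hrep.mul_eq]
  have hab' : C c * b = a := algebraMap_functionField_injective W hab
  have hdeg := natDegree_C_mul_le c b
  rw [hab'] at hdeg
  omega

/-- Hence `P₋₁ = P₀ - Q` is not a constant point. [folklore] -/
theorem maninPt_neg_one_not_mem_range : maninPt W (-1) ∉ Set.range (constPt W) := by
  rintro ⟨T, hT⟩
  by_cases hT0 : T = 0
  · rw [hT0, map_zero] at hT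
    exact maninPt_neg_one_ne_zero W hT.symm
  · have h := xc_constPt_mem (W := W) hT0
    rw [hT] at h
    exact xc_maninPt_neg_one_not_mem h

variable (W) in
/-- **The Lang pull-back `λ = (1 - φ)^* : k(W) → k(W)`**: evaluation at Manin's point
`P₋₁ = (t^q, s^q) - (t, s) = (φ - 1)(Q)`, i.e. the comorphism of the isogeny `φ - 1` (equivalently,
up to the sign automorphism, of Lang's isogeny `1 - φ`). [cite: SilvermanAEC2009, III.4.8–4.10] -/
def lam : W.toAffine.FunctionField →ₐ[F] W.toAffine.FunctionField :=
  fieldEndPt (maninPt W (-1)) maninPt_neg_one_not_mem_range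

/-- `λ` maps the generic point to `P₋₁ = P₀ - Q`. [folklore] -/
@[simp]
theorem map_lam_genPt : Point.map (lam W) (genPt W) = frobPt W - genPt W := by
  rw [lam, map_fieldEndPt_genPt, maninPt_neg_one]

/-- `λ` is injective. [folklore] -/
theorem lam_injective : Function.Injective (lam W) :=
  (lam W).toRingHom.injective

omit [DecidableEq F] in
omit [W.IsElliptic] [DecidableEq F] in
/-- The `q`-power Frobenius commutes with every `k`-algebra endomorphism of `k(W)`. [folklore] -/
theorem frob_comp (f : W.toAffine.FunctionField →ₐ[F] W.toAffine.FunctionField) :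
    (frob W).comp f = f.comp (frob W) := by
  apply AlgHom.ext
  intro z
  simp [frob_apply, map_pow]

/-- **`τ_T(P₀) = P₀ + T`**: translations commute with the Frobenius, which fixes rational points.
[folklore] -/
theorem map_transl_frobPt (T : W.toAffine.Point) :
    Point.map (transl T) (frobPt W) = frobPt W + constPt W T := by
  rw [← map_frob_genPt, Point.map_map, ← frob_comp, ← Point.map_map, map_transl_genPt,
    (Point.map (frob W)).map_add, map_frob_genPt, map_constPt]

/-- **The translations fix `λ(k(W))`**: `τ_T ∘ λ = λ`, since both send `Q` to
`(P₀ + T) - (Q + T) = P₀ - Q`. [cite: SilvermanAEC2009, III.4.8–4.10] -/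
theorem transl_comp_lam (T : W.toAffine.Point) : (transl T).comp (lam W) = lam W := by
  refine algHom_eq_of_map_genPt_eq ?_
  rw [← Point.map_map, map_lam_genPt, (Point.map (transl T)).map_sub, map_transl_frobPt,
    map_transl_genPt, add_sub_add_right_eq_sub]

/-- `τ_T (λ z) = λ z`. [folklore] -/
@[simp]
theorem transl_lam (T : W.toAffine.Point) (z : W.toAffine.FunctionField) :
    transl T (lam W z) = lam W z := by
  rw [← AlgHom.comp_apply, transl_comp_lam]

/-- `translEquiv T (λ z) = λ z`. [folklore] -/
@[simp]
theorem translEquiv_lam (T : W.toAffine.Point) (z : W.toAffine.FunctionField) :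
    translEquiv T (lam W z) = lam W z :=
  transl_lam T z

end Lang

/-! ### Orders of polynomials in `t` and the degree of `k(W)` over `k(a(t)/b(t))` -/

section Degree

open Literature.NumberTheory.DiophantineGeometry
open AlgFunctionField WeierstrassPlaceAtInfinity WeierstrassPlaces WeierstrassGenus
open scoped IntermediateField Classical

variable {W} [W.IsElliptic]

omit [W.IsElliptic] in
/-- **`ord_∞ p(t) = -2 deg p`** for a nonzero polynomial `p ∈ k[X]` (the place at infinity of
`k(W)`; `ord_∞ t = -2`). [cite: SilvermanAEC2009, Prop. II.1.1 and III.§1] -/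
theorem ord_infPlace_algebraMap {p : F[X]} (hp : p ≠ 0) :
    (infPlace W.toAffine).ord (algebraMap F[X] W.toAffine.FunctionField p) = -(2 * p.natDegree : ℕ) := by
  set x := algebraMap F[X] W.toAffine.FunctionField p with hx
  have hx0 : x ≠ 0 := (map_ne_zero_iff _ (algebraMap_functionField_injective W)).mpr hp
  have hval : infValuationF W.toAffine x = WithZero.exp (((2 * p.natDegree : ℕ) : ℤ)) :=
    infValuationF_algebraMap_polynomial W.toAffine hp
  -- `n ≤ ord x ↔ v(x) ≤ v(π)^n ↔ |x|_∞ ≤ exp (-n)`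
  have key : ∀ m : ℤ, -m ≤ (infPlace W.toAffine).ord x ↔ ((2 * p.natDegree : ℕ) : ℤ) ≤ m := by
    intro m
    rw [← (infPlace W.toAffine).valuation_le_zpow_iff_le_ord hx0, infPlace_valuation_le_iff, hval,
      WithZero.exp_le_exp]
  refine le_antisymm ?_ ((key _).2 le_rfl)
  by_contra hlt
  push Not at hlt
  have h := (key (((2 * p.natDegree : ℕ) : ℤ) - 1)).1 (by omega)
  omega

/-- **`ord_v p(t) ≥ 0` at every finite place** (`p(t) ∈ k[W] ⊆ 𝒪_v`). [folklore] -/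
theorem ord_ofPrime_algebraMap_nonneg (v : IsDedekindDomain.HeightOneSpectrum W.toAffine.CoordinateRing)
    (p : F[X]) :
    0 ≤ (PlaceOver.ofPrime F W.toAffine.FunctionField v).ord (algebraMap F[X] W.toAffine.FunctionField p) := by
  refine PlaceOver.ord_nonneg_of_mem _ ?_
  rw [IsScalarTower.algebraMap_apply F[X] W.toAffine.CoordinateRing W.toAffine.FunctionField]
  exact PlaceOver.algebraMap_mem_ofPrime _ _

omit [W.IsElliptic] in
/-- The coefficient at `∞` of the pole divisor of `p(t)`: `(p(t))_∞(∞) = 2 deg p`. [folklore] -/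
theorem negPart_principalDivisor_algebraMap_infPlace {p : F[X]} (hp : p ≠ 0) :
    (principalDivisor F (algebraMap F[X] W.toAffine.FunctionField p))⁻ (infPlace W.toAffine) =
      (2 * p.natDegree : ℕ) := by
  have hx0 : algebraMap F[X] W.toAffine.FunctionField p ≠ 0 :=
    (map_ne_zero_iff _ (algebraMap_functionField_injective W)).mpr hp
  rw [Divisor.negPart_apply, principalDivisor_apply_of_ne_zero hx0, ord_infPlace_algebraMap hp]
  simp

/-- The pole divisor of `p(t)` vanishes at the finite places. [folklore] -/
theorem negPart_principalDivisor_algebraMap_ofPrime {p : F[X]} (hp : p ≠ 0)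
    (v : IsDedekindDomain.HeightOneSpectrum W.toAffine.CoordinateRing) :
    (principalDivisor F (algebraMap F[X] W.toAffine.FunctionField p))⁻
      (PlaceOver.ofPrime F W.toAffine.FunctionField v) = 0 := by
  have hx0 : algebraMap F[X] W.toAffine.FunctionField p ≠ 0 :=
    (map_ne_zero_iff _ (algebraMap_functionField_injective W)).mpr hp
  rw [Divisor.negPart_apply, principalDivisor_apply_of_ne_zero hx0]
  have := ord_ofPrime_algebraMap_nonneg (W := W) v p
  exact max_eq_right (by omega)

/-- **The pole divisor of `p(t)` is `2 deg p · ∞`.** [cite: SilvermanAEC2009, Prop. II.1.1 and III.§1] -/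
theorem negPart_principalDivisor_algebraMap {p : F[X]} (hp : p ≠ 0) :
    (principalDivisor F (algebraMap F[X] W.toAffine.FunctionField p))⁻ =
      Finsupp.single (infPlace W.toAffine) ((2 * p.natDegree : ℕ) : ℤ) := by
  ext P
  rcases eq_infPlace_or_exists_eq_ofPrime W.toAffine P with rfl | ⟨v, rfl⟩
  · rw [negPart_principalDivisor_algebraMap_infPlace hp, Finsupp.single_eq_same]
  · rw [negPart_principalDivisor_algebraMap_ofPrime hp, Finsupp.single_apply,
      if_neg (infPlace_ne_ofPrime W.toAffine v)]

/-- `deg (p(t))_∞ = 2 deg p`. [folklore] -/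
theorem degree_negPart_principalDivisor_algebraMap {p : F[X]} (hp : p ≠ 0) :
    ((principalDivisor F (algebraMap F[X] W.toAffine.FunctionField p))⁻).degree = 2 * p.natDegree := by
  rw [negPart_principalDivisor_algebraMap hp, Divisor.degree_single, degree_infPlace]
  push_cast
  ring

/-- `deg (p(t))_0 = 2 deg p` as well (`deg (p(t)) = 0`). [folklore] -/
theorem degree_posPart_principalDivisor_algebraMap {p : F[X]} (hp : p ≠ 0) :
    ((principalDivisor F (algebraMap F[X] W.toAffine.FunctionField p))⁺).degree = 2 * p.natDegree := by
  have hx0 : algebraMap F[X] W.toAffine.FunctionField p ≠ 0 :=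
    (map_ne_zero_iff _ (algebraMap_functionField_injective W)).mpr hp
  have h := congrArg Divisor.degree
    (posPart_sub_negPart (principalDivisor F (algebraMap F[X] W.toAffine.FunctionField p)))
  rw [map_sub, degree_principalDivisor_eq_zero hx0, degree_negPart_principalDivisor_algebraMap hp] at h
  omega

/-- **Pole divisor of a quotient of polynomials in `t`, pointwise**: for `a, b ≠ 0` with
`deg b ≤ deg a`, `(a(t)/b(t))_∞ ≤ (b(t))_0 + (2 deg a - 2 deg b) · ∞`. [folklore] -/
theorem negPart_principalDivisor_div_le {a b : F[X]} (ha : a ≠ 0) (hb : b ≠ 0)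
    (hab : b.natDegree ≤ a.natDegree) :
    (principalDivisor F (algebraMap F[X] W.toAffine.FunctionField a /
        algebraMap F[X] W.toAffine.FunctionField b))⁻ ≤
      (principalDivisor F (algebraMap F[X] W.toAffine.FunctionField b))⁺ +
        Finsupp.single (infPlace W.toAffine) ((2 * a.natDegree : ℕ) - (2 * b.natDegree : ℕ) : ℤ) := by
  have ha0 : algebraMap F[X] W.toAffine.FunctionField a ≠ 0 :=
    (map_ne_zero_iff _ (algebraMap_functionField_injective W)).mpr ha
  have hb0 : algebraMap F[X] W.toAffine.FunctionField b ≠ 0 :=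
    (map_ne_zero_iff _ (algebraMap_functionField_injective W)).mpr hb
  intro P
  rw [div_eq_mul_inv, principalDivisor_mul ha0 (inv_ne_zero hb0), principalDivisor_inv hb0,
    Finsupp.add_apply, Divisor.negPart_apply, Divisor.posPart_apply, Finsupp.add_apply,
    Finsupp.neg_apply, principalDivisor_apply_of_ne_zero ha0, principalDivisor_apply_of_ne_zero hb0,
    Finsupp.single_apply]
  rcases eq_infPlace_or_exists_eq_ofPrime W.toAffine P with rfl | ⟨v, rfl⟩
  · rw [if_pos rfl, ord_infPlace_algebraMap ha, ord_infPlace_algebraMap hb]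
    have h2 : (2 * b.natDegree : ℤ) ≤ 2 * a.natDegree := by exact_mod_cast Nat.mul_le_mul_left 2 hab
    have hb' : max (-((2 * b.natDegree : ℕ) : ℤ)) 0 = 0 :=
      max_eq_right (neg_nonpos.2 (Nat.cast_nonneg _))
    rw [hb', zero_add]
    exact max_le (by push_cast; omega) (by push_cast; omega)
  · rw [if_neg (infPlace_ne_ofPrime W.toAffine v), add_zero]
    have h1 := ord_ofPrime_algebraMap_nonneg (W := W) v a
    have h2 := ord_ofPrime_algebraMap_nonneg (W := W) v b
    rw [max_eq_left h2]
    exact max_le (by omega) h2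

/-- **`deg (a(t)/b(t))_∞ ≤ 2 deg a`** for `deg b ≤ deg a`. [folklore] -/
theorem degree_negPart_principalDivisor_div_le {a b : F[X]} (ha : a ≠ 0) (hb : b ≠ 0)
    (hab : b.natDegree ≤ a.natDegree) :
    ((principalDivisor F (algebraMap F[X] W.toAffine.FunctionField a /
        algebraMap F[X] W.toAffine.FunctionField b))⁻).degree ≤ 2 * a.natDegree := by
  have hle := negPart_principalDivisor_div_le (W := W) ha hb hab
  have hdeg := Divisor.degree_nonneg_of_nonneg (sub_nonneg.2 hle)
  rw [map_sub, map_add, degree_posPart_principalDivisor_algebraMap hb, Divisor.degree_single,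
    degree_infPlace] at hdeg
  push_cast at hdeg
  have h2 : (2 * b.natDegree : ℤ) ≤ 2 * a.natDegree := by exact_mod_cast Nat.mul_le_mul_left 2 hab
  omega

/-- **`[k(W) : k(a(t)/b(t))] ≤ 2 deg a`** for coprime-or-not `a, b ≠ 0` with `deg b ≤ deg a` and
`a(t)/b(t)` non-constant: the degree is the degree of the pole divisor (Stichtenoth Thm. 1.4.11,
`degree_negPart_principalDivisor_eq`). [cite: Stichtenoth2009, Thm. 1.4.11] -/
theorem finrank_adjoin_div_le {a b : F[X]} (ha : a ≠ 0) (hb : b ≠ 0) (hab : b.natDegree ≤ a.natDegree)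
    (hz : algebraMap F[X] W.toAffine.FunctionField a / algebraMap F[X] W.toAffine.FunctionField b ∉
      Set.range (algebraMap F W.toAffine.FunctionField)) :
    Module.finrank F⟮algebraMap F[X] W.toAffine.FunctionField a / algebraMap F[X] W.toAffine.FunctionField b⟯
        W.toAffine.FunctionField ≤ 2 * a.natDegree := by
  have h := degree_negPart_principalDivisor_eq (K := F) (transcendental_of_not_mem_range hz)
  have h' := degree_negPart_principalDivisor_div_le (W := W) ha hb hab
  rw [h] at h'
  exact_mod_cast h'

end Degree

/-! ### `k(W) / λ(k(W))` is Galois with group `W(k)` -/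

section Galois

open scoped IntermediateField

variable {W} [W.IsElliptic]

omit [W.IsElliptic] in
/-- `s ≠ 0` in `k(W)`. [folklore] -/
theorem gS_ne_zero : gS W ≠ 0 := by
  intro h
  have h' : CoordinateRing.mk W.toAffine Y = 0 := by
    apply IsFractionRing.injective W.toAffine.CoordinateRing W.toAffine.FunctionField
    rw [map_zero]
    exact h
  have := eq_zero_of_add_mul_Y_eq_zero (W := W) (p := 0) (q := 1) (by rw [map_zero, map_one, zero_add, one_mul, h'])
  exact one_ne_zero this.2

omit [W.IsElliptic] in
/-- **`s ∉ k(t)`**: `Y` is not a rational function of `X` on the curve (`{1, Y}` is a basis of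
`k[W]` over `k[X]`). [folklore] -/
theorem gS_not_mem_adjoin_gT : gS W ∉ F⟮gT W⟯ := by
  intro h
  rw [IntermediateField.mem_adjoin_simple_iff] at h
  obtain ⟨r, q, hrq⟩ := h
  have haeval : ∀ p : F[X], aeval (gT W) p = algebraMap F[X] W.toAffine.FunctionField p := fun p => by
    rw [gT, aeval_algebraMap_apply, aeval_X_left, AlgHom.coe_id, id_eq]
  rw [haeval, haeval] at hrq
  have hq : algebraMap F[X] W.toAffine.FunctionField q ≠ 0 := by
    intro hq
    rw [hq, div_zero] at hrq
    exact gS_ne_zero hrq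
  rw [eq_div_iff hq] at hrq
  -- pull back to `k[W]`: `Y · q = r`, so `q = 0`
  have hCR : algebraMap F[X] W.toAffine.CoordinateRing (-r) +
      algebraMap F[X] W.toAffine.CoordinateRing q * CoordinateRing.mk W.toAffine Y = 0 := by
    apply IsFractionRing.injective W.toAffine.CoordinateRing W.toAffine.FunctionField
    rw [map_add, map_mul, map_zero,
      ← IsScalarTower.algebraMap_apply F[X] W.toAffine.CoordinateRing W.toAffine.FunctionField,
      ← IsScalarTower.algebraMap_apply F[X] W.toAffine.CoordinateRing W.toAffine.FunctionField,
      map_neg, ← gS, mul_comm, hrq, neg_add_cancel]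
  have := (eq_zero_of_add_mul_Y_eq_zero (W := W) hCR).2
  exact hq (by rw [this, map_zero])

variable [DecidableEq F] [Fintype F]

/-- `x' := λ(t) = x(P₋₁)`. [folklore] -/
theorem lam_gT : lam W (gT W) = xc W (maninPt W (-1)) := by
  rw [← xc_genPt W, ← xc_map', map_lam_genPt, maninPt_neg_one]

/-- **`[k(W) : k(λ t)] ≤ 2 · #W(k)`**: `λ(t) = x(P₋₁) = a/b` with `deg b < deg a = #W(k)` (Manin), and
the degree over `k(a(t)/b(t))` is the degree `≤ 2 deg a` of the pole divisor.
[cite: ChahalSoomroTop2014, Lemma 1.1] -/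
theorem finrank_adjoin_lam_gT_le :
    Module.finrank F⟮lam W (gT W)⟯ W.toAffine.FunctionField ≤ 2 * Nat.card W.toAffine.Point := by
  rcases st_all W (-1) with ⟨h0, -⟩ | ⟨-, a, b, hrep, hlt, hd⟩
  · exact absurd h0 (maninPt_neg_one_ne_zero W)
  have ha : a ≠ 0 := by rintro rfl; simp at hlt
  have hx : lam W (gT W) = algebraMap F[X] _ a / algebraMap F[X] _ b := by rw [lam_gT, hrep.eq_div]
  have hN : a.natDegree = Nat.card W.toAffine.Point := by
    have := hd.trans (dg_neg_one W)
    exact_mod_cast this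
  rw [hx, ← hN]
  exact finrank_adjoin_div_le ha hrep.ne_zero hlt.le (hx ▸ lam_gT (W := W) ▸ xc_maninPt_neg_one_not_mem)

/-- `λ(s) ∉ k(λ(t))` (transport of `gS_not_mem_adjoin_gT` along the injective `λ`). [folklore] -/
theorem lam_gS_not_mem_adjoin : lam W (gS W) ∉ F⟮lam W (gT W)⟯ := by
  intro h
  have hmap : F⟮lam W (gT W)⟯ = (F⟮gT W⟯).map (lam W) := by
    rw [IntermediateField.adjoin_map, Set.image_singleton]
  rw [hmap, IntermediateField.mem_map] at h
  obtain ⟨z, hz, hzS⟩ := h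
  rw [lam_injective hzS] at hz
  exact gS_not_mem_adjoin_gT hz

/-- `λ(t)` is transcendental over `k`. [folklore] -/
theorem transcendental_lam_gT : Transcendental F (lam W (gT W)) :=
  transcendental_of_not_mem_range (lam_gT (W := W) ▸ xc_maninPt_neg_one_not_mem)

/-- `k(W)` is finite over `k(λ t)`. [folklore] -/
instance finiteDimensional_adjoin_lam_gT : FiniteDimensional F⟮lam W (gT W)⟯ W.toAffine.FunctionField :=
  Literature.NumberTheory.DiophantineGeometry.IsAlgFunctionField.finiteDimensional_adjoin_simple
    transcendental_lam_gT

/-- `k(λ t) ≤ λ(k(W))`. [folklore] -/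
theorem adjoin_lam_gT_le_fieldRange : F⟮lam W (gT W)⟯ ≤ (lam W).fieldRange :=
  IntermediateField.adjoin_simple_le_iff.2 ((lam W).mem_fieldRange.2 ⟨gT W, rfl⟩)

/-- `k(W)` is finite over `λ(k(W))` (which contains `k(λ t)`). [folklore] -/
instance finiteDimensional_fieldRange_lam : FiniteDimensional (lam W).fieldRange W.toAffine.FunctionField :=
  IntermediateField.finiteDimensional_right (K := F⟮lam W (gT W)⟯) (L := W.toAffine.FunctionField)
    (F := IntermediateField.extendScalars adjoin_lam_gT_le_fieldRange)

/-- **`[k(W) : λ(k(W))] ≤ #W(k)`**: `[k(W) : k(λ t)] ≤ 2 #W(k)` and `[λ(k(W)) : k(λ t)] ≥ 2`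
(`λ s ∉ k(λ t)`). [cite: SilvermanAEC2009, III.4.10 and V.§1] -/
theorem finrank_fieldRange_lam_le :
    Module.finrank (lam W).fieldRange W.toAffine.FunctionField ≤ Nat.card W.toAffine.Point := by
  set E₁ : IntermediateField F W.toAffine.FunctionField := F⟮lam W (gT W)⟯ with hE₁
  set E₂ : IntermediateField F W.toAffine.FunctionField := (lam W).fieldRange with hE₂
  have h12 : E₁ ≤ E₂ := adjoin_lam_gT_le_fieldRange
  have hmul := IntermediateField.relfinrank_mul_finrank_top h12
  have hle : Module.finrank E₁ W.toAffine.FunctionField ≤ 2 * Nat.card W.toAffine.Point :=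
    finrank_adjoin_lam_gT_le
  have hpos : 0 < Module.finrank E₁ W.toAffine.FunctionField := Module.finrank_pos
  have hr1 : IntermediateField.relfinrank E₁ E₂ ≠ 1 := by
    rw [ne_eq, IntermediateField.relfinrank_eq_one_iff]
    intro h21
    exact lam_gS_not_mem_adjoin (h21 ((lam W).mem_fieldRange.2 ⟨gS W, rfl⟩))
  have hr0 : IntermediateField.relfinrank E₁ E₂ ≠ 0 := by
    intro h0
    rw [h0, zero_mul] at hmul
    omega
  have hr2 : 2 ≤ IntermediateField.relfinrank E₁ E₂ := by omega
  nlinarith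

omit [W.IsElliptic] [DecidableEq F] in
/-- The points of `W(k)` form a finite set for `k` finite (`W(k) ↪ Option (k × k)`; also in the tree
elsewhere, reproved to keep imports small). [folklore] -/
theorem finite_point : Finite W.toAffine.Point := by
  refine Finite.of_injective (fun P : W.toAffine.Point => match P with
    | .zero => (none : Option (F × F))
    | .some x y _ => some (x, y)) ?_
  intro P Q h
  rcases P with _ | ⟨x, y, hP⟩ <;> rcases Q with _ | ⟨x', y', hQ⟩
  · rfl
  · simp at h
  · simp at h
  · simp only [Option.some.injEq, Prod.mk.injEq] at h
    obtain ⟨rfl, rfl⟩ := h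
    rfl

omit [Fintype F] in
/-- The group of translations `τ(W(k)) ≤ Aut_k k(W)` has order `#W(k)`. [folklore] -/
theorem natCard_range_translHom :
    Nat.card (translHom W).range = Nat.card W.toAffine.Point := by
  rw [← Nat.card_congr (MonoidHom.ofInjective (translHom_injective (W := W))).toEquiv]
  rfl

/-- The translation group is finite. [folklore] -/
instance finite_range_translHom : Finite (translHom W).range :=
  haveI : Finite W.toAffine.Point := finite_point
  Finite.of_equiv _ (MonoidHom.ofInjective (translHom_injective (W := W))).toEquiv

/-- **`λ(k(W))` is contained in the fixed field of the translations.** [folklore] -/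
theorem fieldRange_lam_le_fixedField :
    (lam W).fieldRange ≤ IntermediateField.fixedField (translHom W).range := by
  intro z hz
  obtain ⟨w, rfl⟩ := (lam W).mem_fieldRange.1 hz
  rw [IntermediateField.mem_fixedField_iff]
  rintro f ⟨T, rfl⟩
  exact translEquiv_lam T.toAdd w

/-- **`[k(W) : k(W)^{τ(W(k))}] = #W(k)`** (Artin). [folklore] -/
theorem finrank_fixedField_translHom :
    Module.finrank (IntermediateField.fixedField (translHom W).range) W.toAffine.FunctionField =
      Nat.card W.toAffine.Point := by
  haveI := Fintype.ofFinite (translHom W).range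
  rw [← natCard_range_translHom, Nat.card_eq_fintype_card]
  exact FixedPoints.finrank_eq_card _ W.toAffine.FunctionField

/-- **`λ(k(W))` is the fixed field of the translation group** `τ(W(k))`: it is contained in it and
`[k(W) : λ(k(W))] ≤ #W(k) = [k(W) : k(W)^{τ(W(k))}]`. [cite: SilvermanAEC2009, III.4.10 and V.§1] -/
theorem fieldRange_lam_eq_fixedField :
    (lam W).fieldRange = IntermediateField.fixedField (translHom W).range :=
  IntermediateField.eq_of_le_of_finrank_le' fieldRange_lam_le_fixedField
    (finrank_fieldRange_lam_le.trans finrank_fixedField_translHom.ge)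

/-- **`[k(W) : λ(k(W))] = #W(k)`**, i.e. `deg (φ - 1) = #W(k)` (Silverman *AEC* V.§1, proof of
Thm. V.1.1). [cite: SilvermanAEC2009, V.§1] -/
theorem finrank_fieldRange_lam :
    Module.finrank (lam W).fieldRange W.toAffine.FunctionField = Nat.card W.toAffine.Point := by
  rw [fieldRange_lam_eq_fixedField, finrank_fixedField_translHom]

/-- **`k(W) / λ(k(W))` is Galois** (with group the translations by `W(k)`): the function-field form
of "the Lang isogeny `1 - φ : E → E` is a Galois covering with group `E(k)`". [cite: SilvermanAEC2009, III.4.10 and V.§1] -/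
theorem isGalois_fieldRange_lam : IsGalois (lam W).fieldRange W.toAffine.FunctionField := by
  rw [fieldRange_lam_eq_fixedField]
  exact IsGalois.of_fixed_field W.toAffine.FunctionField (translHom W).range

end Galois

/-! ### The poles of `λ t`, `λ s` at `∞`, and the Artin–Schreier irreducibility hypothesis -/

section ArtinSchreierPrep

open Literature.NumberTheory.DiophantineGeometry
open AlgFunctionField WeierstrassPlaceAtInfinity WeierstrassPlaces

variable {W} [W.IsElliptic]

/-- **Artin–Schreier irreducibility criterion from a pole of order prime to `p`**: if `a ∈ F` has
`ord_v(a) < 0` with `p ∤ ord_v(a)` at some place `v` of a function field of characteristic `p`, then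
`a ∉ ℘(F) = {s^p - s}` (so `X^p - X - a` is irreducible, Lang *Algebra* VI Thm. 6.4 (ii), the tree's
`Literature.FieldTheory.ArtinSchreier.X_pow_sub_X_sub_C_irreducible`): if `s^p - s = a` then
`ord_v s < 0` and `ord_v(s^p - s) = p · ord_v s`. (Stichtenoth Prop. 3.7.8 (a), the hypothesis
`m_P > 0`, `gcd(m_P, p) = 1`.) [cite: Stichtenoth2009, Prop. 3.7.8(a)] -/
theorem _root_.Literature.NumberTheory.DiophantineGeometry.AlgFunctionField.PlaceOver.pow_sub_self_ne_of_ord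
    {k : Type*} {K : Type*} [Field k] [Field K] [Algebra k K] [IsAlgFunctionField k K]
    {p : ℕ} [Fact p.Prime] [CharP K p] (v : PlaceOver k K) {a : K} (ha : a ≠ 0) (hord : v.ord a < 0)
    (hp : ¬ (p : ℤ) ∣ v.ord a) (s : K) : s ^ p - s ≠ a := by
  intro hs
  have hprime : p.Prime := Fact.out
  by_cases hs0 : s = 0
  · rw [hs0, zero_pow hprime.ne_zero, sub_zero] at hs
    exact ha hs.symm
  by_cases hsO : s ∈ v.toValuationSubring
  · -- then `a = s^p - s ∈ 𝒪_v` has nonnegative order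
    have hmem : s ^ p - s ∈ v.toValuationSubring := Subring.sub_mem _ (Subring.pow_mem _ hsO p) hsO
    rw [hs] at hmem
    have := v.ord_nonneg_of_mem hmem
    omega
  · -- `ord s < 0`, `ord (s^p) = p ord s < ord s`, so `ord (s^p - s) = p ord s`
    have hords : v.ord s < 0 := by
      by_contra h
      exact hsO ((v.mem_toValuationSubring_iff_ord_nonneg hs0).2 (not_lt.1 h))
    have hpow : v.ord (s ^ p) = p * v.ord s := v.ord_pow hs0 p
    have hlt : v.ord (s ^ p) < v.ord (-s) := by
      rw [hpow, v.ord_neg]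
      have h2 : (2 : ℤ) ≤ p := by exact_mod_cast hprime.two_le
      nlinarith
    have hsum := v.ord_add_eq_left_of_lt (pow_ne_zero p hs0) (neg_ne_zero.2 hs0) hlt
    rw [← sub_eq_add_neg, hs, hpow] at hsum
    exact hp ⟨v.ord s, hsum.2⟩

variable [DecidableEq F] [Fintype F]

omit [DecidableEq F] in
/-- For `x(P₋₁) = a/b` in lowest terms, `deg a = deg b + 1` (Manin's `step_zero`).
[cite: ChahalSoomroTop2014, Lemma 1.1] -/
theorem natDegree_num_xc_maninPt_neg_one {a b : F[X]} (hrep : IsRep W (xc W (maninPt W (-1))) a b) :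
    a.natDegree = b.natDegree + 1 := by
  obtain ⟨u₁, v₁, hadd⟩ := exists_isRep_xc_maninPt W 1
  rw [maninPt_one] at hadd
  have hsub := hrep
  rw [maninPt_neg_one] at hsub
  exact (step_zero W hadd hsub).2.2.1

/-- `λ t ≠ 0`. [folklore] -/
theorem lam_gT_ne_zero : lam W (gT W) ≠ 0 := by
  rw [map_ne_zero_iff _ lam_injective]
  exact fun h => gT_not_mem_range (W := W) ⟨0, by rw [map_zero, h]⟩

/-- `λ s ≠ 0`. [folklore] -/
theorem lam_gS_ne_zero : lam W (gS W) ≠ 0 := by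
  rw [map_ne_zero_iff _ lam_injective]
  exact gS_ne_zero

/-- **`ord_∞ (λ t) = -2`**: `λ t = x(P₋₁) = a(t)/b(t)` with `deg a = deg b + 1` and
`ord_∞ p(t) = -2 deg p`. (So `λ t` has a pole of order `2 = deg x` at the rational place `∞`.)
[cite: ChahalSoomroTop2014, Lemma 1.1] -/
theorem ord_infPlace_lam_gT : (infPlace W.toAffine).ord (lam W (gT W)) = -2 := by
  obtain ⟨a, b, hrep⟩ := exists_isRep_xc_maninPt W (-1)
  have hab := natDegree_num_xc_maninPt_neg_one hrep
  have ha : a ≠ 0 := by rintro rfl; simp at hab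
  have ha0 : algebraMap F[X] W.toAffine.FunctionField a ≠ 0 :=
    (map_ne_zero_iff _ (algebraMap_functionField_injective W)).mpr ha
  have hb0 : algebraMap F[X] W.toAffine.FunctionField b ≠ 0 :=
    (map_ne_zero_iff _ (algebraMap_functionField_injective W)).mpr hrep.ne_zero
  rw [lam_gT, hrep.eq_div, (infPlace W.toAffine).ord_div ha0 hb0, ord_infPlace_algebraMap ha,
    ord_infPlace_algebraMap hrep.ne_zero, hab]
  push_cast
  ring

/-- **`ord_∞ (λ s) = -3`**: from the Weierstrass equation for the point `(λ t, λ s)` read through the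
valuation `|·|_∞ ∘ λ` (the tree's `WeierstrassPlaces.map_y_sq`: `|y|² = |x|³` at a pole of `x`).
[cite: SilvermanAEC2009, Prop. III.3.1 (`ord_O y = -3`)] -/
theorem ord_infPlace_lam_gS : (infPlace W.toAffine).ord (lam W (gS W)) = -3 := by
  set v := infPlace W.toAffine with hv
  let w : Valuation W.toAffine.FunctionField _ := v.valuation.comap (lam W).toRingHom
  have hK : ∀ c : F, w (algebraMap F W.toAffine.FunctionField c) ≤ 1 := fun c => by
    change v.valuation (lam W (algebraMap F W.toAffine.FunctionField c)) ≤ 1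
    rw [AlgHom.commutes]
    exact v.toValuationSubring.valuation_le_one ⟨_, v.algebraMap_mem c⟩
  have h1 : v.valuation (lam W (gT W)) = v.valuation (v.uniformizer : W.toAffine.FunctionField) ^ (-2 : ℤ) := by
    rw [v.valuation_eq_zpow_ord lam_gT_ne_zero, ord_infPlace_lam_gT]
  have hx : 1 < w (algebraMap F[X] W.toAffine.FunctionField X) := by
    change 1 < v.valuation (lam W (gT W))
    rw [h1, zpow_neg, one_lt_inv₀ (zpow_pos v.valuation_uniformizer_pos _)]
    exact zpow_lt_one₀ v.valuation_uniformizer_pos v.valuation_uniformizer_lt_one (by norm_num)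
  have hsq := WeierstrassPlaces.map_y_sq W.toAffine w hK hx
  change v.valuation (lam W (gS W)) ^ 2 = v.valuation (lam W (gT W)) ^ 3 at hsq
  rw [v.valuation_eq_zpow_ord lam_gS_ne_zero, h1, ← zpow_natCast, ← zpow_mul, ← zpow_natCast,
    ← zpow_mul] at hsq
  have hinj := (zpow_right_strictAnti₀ v.valuation_uniformizer_pos v.valuation_uniformizer_lt_one).injective hsq
  push_cast at hinj
  omega

omit [W.IsElliptic] [DecidableEq F] [Fintype F] in
/-- Nonzero constants have order `0` at every place. [cite: Stichtenoth2009, I.1.5 and I.1.11 (5)] -/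
theorem ord_algebraMap_const (v : PlaceOver F W.toAffine.FunctionField) {c : F} (hc : c ≠ 0) :
    v.ord (algebraMap F W.toAffine.FunctionField c) = 0 :=
  AlgFunctionField.PlaceOver.ord_algebraMap_holds v hc

omit [W.IsElliptic] [DecidableEq F] [Fintype F] in
/-- The function field `k(W)` has the characteristic of `k`. [folklore] -/
theorem charP_functionField (p : ℕ) [CharP F p] : CharP W.toAffine.FunctionField p :=
  charP_of_injective_algebraMap (algebraMap F W.toAffine.FunctionField).injective p

/-- **`α λ t ∉ ℘(k(W))` for `α ≠ 0` and `p ≠ 2`** (`ord_∞(α λ t) = -2` is prime to `p`): the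
Artin–Schreier polynomial `Z^p - Z - α λ t` is irreducible over `k(W)`.
[cite: Stichtenoth2009, Prop. 3.7.8(a)] -/
theorem pow_sub_self_ne_smul_lam_gT {p : ℕ} [Fact p.Prime] [CharP F p] (hp2 : p ≠ 2) {α : F}
    (hα : α ≠ 0) (s : W.toAffine.FunctionField) :
    s ^ p - s ≠ algebraMap F W.toAffine.FunctionField α * lam W (gT W) := by
  haveI := charP_functionField (W := W) p
  have hα0 : algebraMap F W.toAffine.FunctionField α ≠ 0 := (_root_.map_ne_zero _).2 hα
  refine (infPlace W.toAffine).pow_sub_self_ne_of_ord (mul_ne_zero hα0 lam_gT_ne_zero) ?_ ?_ s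
  · rw [(infPlace W.toAffine).ord_mul_eq hα0 lam_gT_ne_zero, ord_algebraMap_const _ hα,
      ord_infPlace_lam_gT]
    norm_num
  · rw [(infPlace W.toAffine).ord_mul_eq hα0 lam_gT_ne_zero, ord_algebraMap_const _ hα,
      ord_infPlace_lam_gT, zero_add]
    intro h
    have hprime : p.Prime := Fact.out
    have h2 : (p : ℤ) ∣ 2 := (Int.dvd_neg).1 h
    have : p ∣ 2 := by exact_mod_cast h2
    exact hp2 ((Nat.prime_dvd_prime_iff_eq hprime Nat.prime_two).1 this)

/-- **`α λ s ∉ ℘(k(W))` for `α ≠ 0` and `p ≠ 3`** (`ord_∞(α λ s) = -3` is prime to `p`): the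
Artin–Schreier polynomial `Z^p - Z - α λ s` is irreducible over `k(W)`.
[cite: Stichtenoth2009, Prop. 3.7.8(a)] -/
theorem pow_sub_self_ne_smul_lam_gS {p : ℕ} [Fact p.Prime] [CharP F p] (hp3 : p ≠ 3) {α : F}
    (hα : α ≠ 0) (s : W.toAffine.FunctionField) :
    s ^ p - s ≠ algebraMap F W.toAffine.FunctionField α * lam W (gS W) := by
  haveI := charP_functionField (W := W) p
  have hα0 : algebraMap F W.toAffine.FunctionField α ≠ 0 := (_root_.map_ne_zero _).2 hα
  refine (infPlace W.toAffine).pow_sub_self_ne_of_ord (mul_ne_zero hα0 lam_gS_ne_zero) ?_ ?_ s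
  · rw [(infPlace W.toAffine).ord_mul_eq hα0 lam_gS_ne_zero, ord_algebraMap_const _ hα,
      ord_infPlace_lam_gS]
    norm_num
  · rw [(infPlace W.toAffine).ord_mul_eq hα0 lam_gS_ne_zero, ord_algebraMap_const _ hα,
      ord_infPlace_lam_gS, zero_add]
    intro h
    have hprime : p.Prime := Fact.out
    have h3 : (p : ℤ) ∣ 3 := (Int.dvd_neg).1 h
    have : p ∣ 3 := by exact_mod_cast h3
    exact hp3 ((Nat.prime_dvd_prime_iff_eq hprime Nat.prime_three).1 this)

end ArtinSchreierPrep

end Literature.NumberTheory.EllipticCurves.LangTorsor
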